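import Literature.NumberTheory.Sieve.BetaSievePointwise
import Mathlib.NumberTheory.ArithmeticFunction.Liouville
import HarnessLib

/-!
# Matomäki–Merikoski Lemma 2.4, sieve step: inserting the upper `β`-sieve and swapping sums (§6, middle)

Sibling of `Literature/Barriers/Parity/SiegelZeroPrimePairsChiSumsPrep.lean`. Everything in this file is
PROVED. For the sum `H = ∑_{n ≤ N, (n, P(z)) = 1} λ_L(n) w(n)` (`λ_L` the Liouville function, `w` a weight
with `|w(n)| ≤ W/n`) this file carries out the next two steps of §6 of Matomäki–Merikoski (arXiv:2112.11412,
proof of Lemma 2.4):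

* "We deal with the condition `(n, P(z)) = 1` using Lemma 3.2 (i)": with `Θ(n) = ∑_{d ∣ (n, P(z))} λ_d`
  (`λ_d = μ(d)χ⁺(d)` the upper `β`-sieve weights, `BetaSieve.ind 1 β D`),
  `|H − ∑_{n ≤ N} Θ(n) λ_L(n) w(n)| ≤ W ∑_{1 ≤ r ≤ N, log D < (r+β) log z} 2^{−Ar} ∑_{n ≤ N, (n, P(z^{θ^r})) = 1} τ(n)^{A+1}/n`
  (`MatomakiMerikoski.abs_sum_rough_sub_sum_sieve_le`, from the tree's `BetaSieve.sum_weights_le`,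
  `BetaSieve.indicator_le_sum_weights`);
* the swap `∑_{n ≤ N} Θ(n) λ_L(n) w(n) = ∑_{d ∣ P(z)} λ_d λ_L(d) ∑_{m ≤ N/d} λ_L(m) w(dm)`
  (`MatomakiMerikoski.sum_sieve_mul_eq`, `sum_sieve_liouville_eq`, complete multiplicativity of `λ_L`), and for the weight of the
  source, `w(n) = log(y/n)/n`: `∑_{m ≤ M} λ_L(m) log(y/(dm))/(dm) = (log(y/d) ∑_{m ≤ M} λ_L(m)/m − ∑_{m ≤ M} λ_L(m) log m/m)/d`
  (`MatomakiMerikoski.sum_liouville_log_div_mul_eq`), whose two sums are evaluated in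
  `LiouvilleHarmonicSum.lean` / `LiouvilleLogHarmonicSum.lean`.

Here `P(z)` is written `∏ p ∈ (Nat.primesBelow ⌈z⌉₊).filter (¬ · ∣ 1), p` (the `v = 1` case of the sifting
range of `BetaSievePointwise.lean`), and "`(n, P(z)) = 1`" both as `Nat.gcd n P(z) = 1` and as the filter
"all prime factors `≥ z`" (`MatomakiMerikoski.gcd_eq_one_iff_rough`).

## References

* K. Matomäki, J. Merikoski, IMRN 2023 (arXiv:2112.11412), §6 (proof of Lemma 2.4), fourth to sixth
  displays. [cite: MatomakiMerikoski2023, §6]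
-/

noncomputable section

open Finset Real ArithmeticFunction
open scoped ArithmeticFunction.Moebius

namespace Literature.Barriers.Parity.MatomakiMerikoski

open Literature.NumberTheory.Sieve Literature.NumberTheory.Sieve.BetaSieve

/-! ### The sifting range `P(z)` and rough numbers -/

/-- Membership in the prime factors of `P(w) = ∏_{p < w, p ∤ 1} p`: exactly the primes `< w`. [folklore] -/
theorem mem_primeFactors_siftingProd {w : ℝ} {p : ℕ} :
    p ∈ (∏ p ∈ (Nat.primesBelow ⌈w⌉₊).filter (fun p : ℕ => ¬ p ∣ 1), p).primeFactors ↔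
      p.Prime ∧ (p : ℝ) < w := by
  rw [mem_primeFactors_prod_primesBelow_filter]
  constructor
  · rintro ⟨hp, hw, -⟩; exact ⟨hp, hw⟩
  · rintro ⟨hp, hw⟩; exact ⟨hp, hw, fun h => hp.ne_one (Nat.dvd_one.mp h)⟩

/-- **`(n, P(w)) = 1` iff all prime factors of `n` are `≥ w`** (`n ≠ 0`). [folklore] -/
theorem gcd_eq_one_iff_rough {w : ℝ} {n : ℕ} (hn : n ≠ 0) :
    Nat.gcd n (∏ p ∈ (Nat.primesBelow ⌈w⌉₊).filter (fun p : ℕ => ¬ p ∣ 1), p) = 1 ↔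
      ∀ p ∈ n.primeFactors, w ≤ ((p : ℕ) : ℝ) := by
  set P : ℕ := ∏ p ∈ (Nat.primesBelow ⌈w⌉₊).filter (fun p : ℕ => ¬ p ∣ 1), p with hP
  have hP0 : P ≠ 0 := (squarefree_prod_primesBelow_filter w 1).ne_zero
  rw [← Nat.coprime_iff_gcd_eq_one]
  constructor
  · intro h p hp
    by_contra hlt
    rw [not_le] at hlt
    have hpp := Nat.prime_of_mem_primeFactors hp
    have hpP : p ∈ P.primeFactors := mem_primeFactors_siftingProd.mpr ⟨hpp, hlt⟩
    have h1 : p ∣ Nat.gcd n P := Nat.dvd_gcd (Nat.dvd_of_mem_primeFactors hp) (Nat.dvd_of_mem_primeFactors hpP)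
    rw [Nat.Coprime.gcd_eq_one h] at h1
    exact hpp.ne_one (Nat.dvd_one.mp h1)
  · intro h
    refine Nat.coprime_of_dvd fun p hpp hpn hpP => ?_
    have h1 : p ∈ P.primeFactors := Nat.mem_primeFactors.mpr ⟨hpp, hpP, hP0⟩
    have h2 := (mem_primeFactors_siftingProd.mp h1).2
    have h3 := h p (Nat.mem_primeFactors.mpr ⟨hpp, hpn, hn⟩)
    linarith

/-! ### Step 3: inserting the sieve -/

/-- **Sieve insertion** (§6: "We deal with the condition `(n, P(z)) = 1` using Lemma 3.2 (i)"). Let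
`β > 1`, `1 < z`, `1 < D`, `β log z ≤ log D`, `A : ℕ`, and `|w(n)| ≤ W/n` on `1 ≤ n ≤ N`. With
`Θ(n) = ∑_{d ∣ (n, P(z))} μ(d)χ⁺(d)` and `θ = 1 − 1/β`:
`|∑_{n ≤ N, (n,P(z))=1} λ_L(n) w(n) − ∑_{n ≤ N} Θ(n) λ_L(n) w(n)|
  ≤ W ∑_{1 ≤ r ≤ N, log D < (r+β) log z} 2^{−Ar} ∑_{n ≤ N, (n, P(z^{θ^r})) = 1} τ(n)^{A+1}/n`.
[cite: MatomakiMerikoski2023, §6 (fourth and fifth displays)] -/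
theorem abs_sum_rough_sub_sum_sieve_le {β D z : ℝ} (hβ : 1 < β) (hz : 1 < z) (hD1 : 1 < D)
    (hzD : β * Real.log z ≤ Real.log D) (A N : ℕ) {w : ℕ → ℝ} {W : ℝ} (hW0 : 0 ≤ W)
    (hw : ∀ n ∈ Icc 1 N, |w n| ≤ W / n) :
    |∑ n ∈ (Icc 1 N).filter (fun n => ∀ p ∈ n.primeFactors, z ≤ ((p : ℕ) : ℝ)), (liouville n : ℝ) * w n -
      ∑ n ∈ Icc 1 N, (∑ d ∈ (Nat.gcd n (∏ p ∈ (Nat.primesBelow ⌈z⌉₊).filter (fun p : ℕ => ¬ p ∣ 1), p)).divisors,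
        (μ d : ℝ) * ind 1 β D d) * ((liouville n : ℝ) * w n)| ≤
      W * ∑ r ∈ Icc 1 N, (if Real.log D < ((r : ℕ) + β) * Real.log z then
        (∑ n ∈ (Icc 1 N).filter (fun n => Nat.gcd n (∏ p ∈ (Nat.primesBelow ⌈z ^ ((1 - 1 / β) ^ r)⌉₊).filter
            (fun p : ℕ => ¬ p ∣ 1), p) = 1), ((n.divisors.card : ℝ) ^ (A + 1) / n)) / 2 ^ (A * r) else 0) := by
  classical
  set P : ℕ := ∏ p ∈ (Nat.primesBelow ⌈z⌉₊).filter (fun p : ℕ => ¬ p ∣ 1), p with hP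
  set Pr : ℕ → ℕ := fun r => ∏ p ∈ (Nat.primesBelow ⌈z ^ ((1 - 1 / β) ^ r)⌉₊).filter
    (fun p : ℕ => ¬ p ∣ 1), p with hPr
  set Θ : ℕ → ℝ := fun n => ∑ d ∈ (Nat.gcd n P).divisors, (μ d : ℝ) * ind 1 β D d with hΘ
  set E : ℕ → ℝ := fun n => ∑ r ∈ Icc 1 n.primeFactors.card,
    (if Real.log D < ((r : ℕ) + β) * Real.log z then
      (n.divisors.card : ℝ) ^ (A + 1) / 2 ^ (A * r) * (if Nat.gcd n (Pr r) = 1 then (1 : ℝ) else 0) else 0) with hE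
  -- the rough sum as a sum over `Icc 1 N` with the indicator `𝟙_{(n,P)=1}`
  have hrough : ∑ n ∈ (Icc 1 N).filter (fun n => ∀ p ∈ n.primeFactors, z ≤ ((p : ℕ) : ℝ)),
      (liouville n : ℝ) * w n =
      ∑ n ∈ Icc 1 N, (if Nat.gcd n P = 1 then (1 : ℝ) else 0) * ((liouville n : ℝ) * w n) := by
    rw [Finset.sum_filter]
    refine Finset.sum_congr rfl fun n hn => ?_
    have hn0 : n ≠ 0 := by have := (mem_Icc.mp hn).1; omega
    by_cases h : ∀ p ∈ n.primeFactors, z ≤ ((p : ℕ) : ℝ)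
    · rw [if_pos h, if_pos ((gcd_eq_one_iff_rough hn0).mpr h), one_mul]
    · rw [if_neg h, if_neg (fun h' => h ((gcd_eq_one_iff_rough hn0).mp h')), zero_mul]
  rw [hrough, ← Finset.sum_sub_distrib]
  -- termwise: `|(𝟙 − Θ) λ_L w| ≤ E(n) · W/n`
  have hliou : ∀ n, |(liouville n : ℝ)| ≤ 1 := fun n => by
    rcases eq_or_ne n 0 with rfl | hn0
    · simp
    · rw [ArithmeticFunction.liouville_apply hn0]; simp
  have hterm : ∀ n ∈ Icc 1 N, |(if Nat.gcd n P = 1 then (1 : ℝ) else 0) * ((liouville n : ℝ) * w n) -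
      Θ n * ((liouville n : ℝ) * w n)| ≤ E n * (W / n) := by
    intro n hn
    have hn0 : n ≠ 0 := by have := (mem_Icc.mp hn).1; omega
    have hlow : (if Nat.gcd n P = 1 then (1 : ℝ) else 0) ≤ Θ n := indicator_le_sum_weights z n 1
    have hup : Θ n ≤ (if Nat.gcd n P = 1 then (1 : ℝ) else 0) + E n := sum_weights_le hβ hz hD1 hzD hn0 1 A
    have hE0 : 0 ≤ Θ n - (if Nat.gcd n P = 1 then (1 : ℝ) else 0) := by linarith
    have hE1 : Θ n - (if Nat.gcd n P = 1 then (1 : ℝ) else 0) ≤ E n := by linarith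
    rw [← sub_mul, abs_mul, abs_sub_comm, abs_of_nonneg hE0, abs_mul]
    exact mul_le_mul hE1 (mul_le_mul (hliou n) (hw n hn) (abs_nonneg _) zero_le_one |>.trans_eq (one_mul _))
      (by positivity) ((hE0.trans hE1))
  refine (abs_sum_le_sum_abs _ _).trans ((Finset.sum_le_sum hterm).trans ?_)
  -- the summand of the `r`-sum, for a given `n`
  set F : ℕ → ℕ → ℝ := fun r n =>
    (if Real.log D < ((r : ℕ) + β) * Real.log z then
      (n.divisors.card : ℝ) ^ (A + 1) / 2 ^ (A * r) * (if Nat.gcd n (Pr r) = 1 then (1 : ℝ) else 0) * (W / n)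
      else 0) with hF
  have hF0 : ∀ r n, 0 ≤ F r n := fun r n => by
    simp only [hF]
    split_ifs <;> positivity
  -- (1) `E(n) W/n ≤ ∑_{r ∈ Icc 1 N} F r n`
  have hstep1 : ∀ n ∈ Icc 1 N, E n * (W / n) ≤ ∑ r ∈ Icc 1 N, F r n := by
    intro n hn
    obtain ⟨hn1, hnN⟩ := mem_Icc.mp hn
    have hω : n.primeFactors.card ≤ N := by
      have h1 : n.primeFactors ⊆ Icc 1 n := fun p hp =>
        mem_Icc.mpr ⟨(Nat.prime_of_mem_primeFactors hp).one_lt.le, Nat.le_of_mem_primeFactors hp⟩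
      calc n.primeFactors.card ≤ (Icc 1 n).card := Finset.card_le_card h1
        _ = n := by simp
        _ ≤ N := hnN
    have heq : E n * (W / n) = ∑ r ∈ Icc 1 n.primeFactors.card, F r n := by
      rw [hE, Finset.sum_mul]
      refine Finset.sum_congr rfl fun r _ => ?_
      simp only [hF]
      split_ifs <;> ring
    rw [heq]
    exact Finset.sum_le_sum_of_subset_of_nonneg (Icc_subset_Icc le_rfl hω) fun r _ _ => hF0 r n
  refine (Finset.sum_le_sum hstep1).trans ?_
  -- (2) swap and identify
  rw [Finset.sum_comm, Finset.mul_sum]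
  refine Finset.sum_le_sum fun r _ => le_of_eq ?_
  by_cases hc : Real.log D < ((r : ℕ) + β) * Real.log z
  · simp only [hF, if_pos hc]
    rw [Finset.sum_filter, mul_div_assoc', eq_div_iff (by positivity), Finset.sum_mul, Finset.mul_sum]
    refine Finset.sum_congr rfl fun n hn => ?_
    have hn0 : (n : ℝ) ≠ 0 := by
      have := (mem_Icc.mp hn).1; exact_mod_cast (show n ≠ 0 by omega)
    simp only [hPr]
    split_ifs
    · field_simp
    · simp
  · simp only [hF, if_neg hc]
    simp

/-! ### Step 4: swapping the sums -/

/-- **Swapping the sums** (§6: "`∑_{d ∣ P(z)} λ_d λ_L(d) d⁻¹ ∑_{n ≤ N/d} λ_L(n) …`", first half): for any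
coefficients `λ_d` and any `g`,
`∑_{n ≤ N} (∑_{d ∣ (n, P)} λ_d) g(n) = ∑_{d ∣ P} λ_d ∑_{m ≤ N/d} g(dm)` (`P ≠ 0`). [folklore] -/
theorem sum_sieve_mul_eq {P : ℕ} (hP : P ≠ 0) (N : ℕ) (lam g : ℕ → ℝ) :
    ∑ n ∈ Icc 1 N, (∑ d ∈ (Nat.gcd n P).divisors, lam d) * g n =
      ∑ d ∈ P.divisors, lam d * ∑ m ∈ Icc 1 (N / d), g (d * m) := by
  classical
  -- `(n, P).divisors = {d ∣ P : d ∣ n}` for `n ≠ 0`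
  have hdiv : ∀ n ∈ Icc 1 N, ∑ d ∈ (Nat.gcd n P).divisors, lam d =
      ∑ d ∈ P.divisors, (if d ∣ n then lam d else 0) := by
    intro n hn
    have hn0 : n ≠ 0 := by have := (mem_Icc.mp hn).1; omega
    rw [← Finset.sum_filter]
    congr 1
    ext d
    simp only [Nat.mem_divisors, mem_filter, Nat.dvd_gcd_iff]
    constructor
    · rintro ⟨⟨hdn, hdP⟩, -⟩; exact ⟨⟨hdP, hP⟩, hdn⟩
    · rintro ⟨⟨hdP, -⟩, hdn⟩; exact ⟨⟨hdn, hdP⟩, Nat.gcd_ne_zero_left hn0⟩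
  have h2 : ∑ n ∈ Icc 1 N, (∑ d ∈ (Nat.gcd n P).divisors, lam d) * g n =
      ∑ n ∈ Icc 1 N, (∑ d ∈ P.divisors, (if d ∣ n then lam d else 0)) * g n :=
    Finset.sum_congr rfl fun n hn => by rw [hdiv n hn]
  rw [h2]
  simp_rw [Finset.sum_mul]
  rw [Finset.sum_comm]
  refine Finset.sum_congr rfl fun d hd => ?_
  have hd0 : 0 < d := Nat.pos_of_mem_divisors hd
  rw [Finset.mul_sum]
  -- `∑_{n ≤ N} [d ∣ n] λ_d g(n) = ∑_{m ≤ N/d} λ_d g(dm)`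
  have h1 : ∑ n ∈ Icc 1 N, (if d ∣ n then lam d else 0) * g n =
      ∑ n ∈ (Icc 1 N).filter (fun n => d ∣ n), lam d * g n := by
    rw [Finset.sum_filter]
    refine Finset.sum_congr rfl fun n _ => ?_
    split_ifs <;> simp
  -- the multiples of `d` in `[1, N]` are `d · [1, N/d]` (cf. the tree's
  -- `FriedlanderIwaniecPrimes.filter_dvd_Icc_eq_image_mul`, inlined to keep the imports light)
  have himg : (Icc 1 N).filter (fun n => d ∣ n) = (Icc 1 (N / d)).image (fun m => d * m) := by
    ext n
    simp only [mem_filter, mem_Icc, mem_image]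
    constructor
    · rintro ⟨⟨hn1, hnN⟩, m, rfl⟩
      refine ⟨m, ⟨Nat.one_le_iff_ne_zero.mpr ?_, ?_⟩, rfl⟩
      · rintro rfl; simp at hn1
      · exact (Nat.le_div_iff_mul_le hd0).mpr (by rw [mul_comm]; exact hnN)
    · rintro ⟨m, ⟨hm1, hmN⟩, rfl⟩
      refine ⟨⟨Nat.one_le_iff_ne_zero.mpr (mul_ne_zero hd0.ne' (by omega)), ?_⟩, dvd_mul_right d m⟩
      have := (Nat.le_div_iff_mul_le hd0).mp hmN
      rw [mul_comm]; exact this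
  rw [h1, himg, Finset.sum_image]
  rintro m₁ _ m₂ _ h
  exact Nat.eq_of_mul_eq_mul_left hd0 h

/-- **Swapping the sums, for `λ_L`-twisted weights**: with `g(n) = λ_L(n) w(n)` and `λ_L` completely
multiplicative, `∑_{n ≤ N} (∑_{d ∣ (n,P)} λ_d) λ_L(n) w(n) = ∑_{d ∣ P} λ_d λ_L(d) ∑_{m ≤ N/d} λ_L(m) w(dm)`.
[cite: MatomakiMerikoski2023, §6 (sixth display)] -/
theorem sum_sieve_liouville_eq {P : ℕ} (hP : P ≠ 0) (N : ℕ) (lam w : ℕ → ℝ) :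
    ∑ n ∈ Icc 1 N, (∑ d ∈ (Nat.gcd n P).divisors, lam d) * ((liouville n : ℝ) * w n) =
      ∑ d ∈ P.divisors, lam d * (liouville d : ℝ) * ∑ m ∈ Icc 1 (N / d), (liouville m : ℝ) * w (d * m) := by
  rw [sum_sieve_mul_eq hP N lam (fun n => (liouville n : ℝ) * w n)]
  refine Finset.sum_congr rfl fun d _ => ?_
  rw [mul_assoc, Finset.mul_sum, Finset.mul_sum, Finset.mul_sum]
  refine Finset.sum_congr rfl fun m _ => ?_
  show lam d * ((liouville (d * m) : ℝ) * w (d * m)) = _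
  rw [ArithmeticFunction.liouville_apply_mul d m, Int.cast_mul]
  ring

/-- **The weight of the source**: for `d ≥ 1`, `y > 0`,
`∑_{m ≤ M} λ_L(m) log(y/(dm))/(dm) = (log(y/d) ∑_{m ≤ M} λ_L(m)/m − ∑_{m ≤ M} λ_L(m) log m/m)/d`
(the two sums on the right are `LiouvilleHarmonicSum` / `LiouvilleLogHarmonicSum` material).
[cite: MatomakiMerikoski2023, §6 ("`∑_n λ_L(n) log(y/(dn)) n^{−s} = F(s) log(y/d) + F'(s)`")] -/
theorem sum_liouville_log_div_mul_eq {d : ℕ} (hd : 0 < d) {y : ℝ} (hy : 0 < y) (M : ℕ) :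
    ∑ m ∈ Icc 1 M, (liouville m : ℝ) * (Real.log (y / ((d * m : ℕ) : ℝ)) / ((d * m : ℕ) : ℝ)) =
      (Real.log (y / d) * ∑ m ∈ Icc 1 M, (liouville m : ℝ) / m -
        ∑ m ∈ Icc 1 M, (liouville m : ℝ) * Real.log m / m) / d := by
  have hd0 : (0 : ℝ) < d := by exact_mod_cast hd
  rw [Finset.mul_sum, ← Finset.sum_sub_distrib, Finset.sum_div]
  refine Finset.sum_congr rfl fun m hm => ?_
  have hm0 : (0 : ℝ) < m := by exact_mod_cast (mem_Icc.mp hm).1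
  have hlog : Real.log (y / ((d * m : ℕ) : ℝ)) = Real.log (y / d) - Real.log m := by
    push_cast
    rw [show y / ((d : ℝ) * m) = y / d / m by rw [div_div], Real.log_div (by positivity) hm0.ne']
  rw [hlog]
  push_cast
  field_simp

/-! ### The main term `(π²/6) ∑_{d ∣ P} λ_d λ_L(d)/d` and the error of the inner sums -/

/-- **Main term extraction** (§6: "the main term … `F'(1) ∑_{d ∣ P(z)} λ_d λ_L(d) d⁻¹`", with the
real-variable evaluations `∑_{m ≤ M} λ_L(m)/m = m_L(M)`, `∑_{m ≤ M} λ_L(m) log m/m = G_L(M)` kept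
explicit): for `P ≠ 0`, `y > 0` and the upper-sieve coefficients `λ_d = μ(d)χ⁺(d)`,
`|∑_{n ≤ N} Θ(n) λ_L(n) log(y/n)/n − (π²/6) ∑_{d ∣ P} λ_d λ_L(d)/d|
  ≤ ∑_{d ∣ P} χ⁺(d)/d · (|log(y/d)| |m_L(N/d)| + |G_L(N/d) + π²/6|)`.
[cite: MatomakiMerikoski2023, §6 (sixth and seventh displays)] -/
theorem abs_sum_sieve_liouville_log_sub_le {β D : ℝ} {P : ℕ} (hP : P ≠ 0) (N : ℕ) {y : ℝ} (hy : 0 < y) :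
    |∑ n ∈ Icc 1 N, (∑ d ∈ (Nat.gcd n P).divisors, (μ d : ℝ) * ind 1 β D d) *
        ((liouville n : ℝ) * (Real.log (y / n) / n)) -
      π ^ 2 / 6 * ∑ d ∈ P.divisors, (μ d : ℝ) * ind 1 β D d * (liouville d : ℝ) / d| ≤
      ∑ d ∈ P.divisors, ind 1 β D d / d *
        (|Real.log (y / d)| * |∑ m ∈ Icc 1 (N / d), (liouville m : ℝ) / m| +
          |∑ m ∈ Icc 1 (N / d), (liouville m : ℝ) * Real.log m / m + π ^ 2 / 6|) := by
  have hliou : ∀ n, |(liouville n : ℝ)| ≤ 1 := fun n => by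
    rcases eq_or_ne n 0 with rfl | hn0
    · simp
    · rw [ArithmeticFunction.liouville_apply hn0]; simp
  -- swap the sums and evaluate the inner sums
  have hswap := sum_sieve_liouville_eq hP N (fun d => (μ d : ℝ) * ind 1 β D d)
    (fun n => Real.log (y / n) / n)
  have hinner : ∀ d ∈ P.divisors, ∑ m ∈ Icc 1 (N / d), (liouville m : ℝ) *
      (fun n : ℕ => Real.log (y / n) / n) (d * m) =
      (Real.log (y / d) * ∑ m ∈ Icc 1 (N / d), (liouville m : ℝ) / m -
        ∑ m ∈ Icc 1 (N / d), (liouville m : ℝ) * Real.log m / m) / d := by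
    intro d hd
    exact sum_liouville_log_div_mul_eq (Nat.pos_of_mem_divisors hd) hy (N / d)
  rw [hswap, Finset.sum_congr rfl fun d hd => by rw [hinner d hd], Finset.mul_sum, ← Finset.sum_sub_distrib]
  refine (abs_sum_le_sum_abs _ _).trans (Finset.sum_le_sum fun d hd => ?_)
  have hd0 : (0 : ℝ) < d := by exact_mod_cast Nat.pos_of_mem_divisors hd
  set mL := ∑ m ∈ Icc 1 (N / d), (liouville m : ℝ) / m with hmL
  set gL := ∑ m ∈ Icc 1 (N / d), (liouville m : ℝ) * Real.log m / m with hgL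
  have hind0 : 0 ≤ ind 1 β D d := ind_nonneg d
  have hμ : |(μ d : ℝ)| ≤ 1 := by exact_mod_cast ArithmeticFunction.abs_moebius_le_one
  have hcoef : |(μ d : ℝ) * ind 1 β D d * (liouville d : ℝ)| ≤ ind 1 β D d := by
    rw [abs_mul, abs_mul, abs_of_nonneg hind0]
    calc |(μ d : ℝ)| * ind 1 β D d * |(liouville d : ℝ)| ≤ 1 * ind 1 β D d * 1 :=
          mul_le_mul (mul_le_mul_of_nonneg_right hμ hind0) (hliou d) (abs_nonneg _)
            (by rw [one_mul]; exact hind0)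
      _ = ind 1 β D d := by ring
  have hexpr : (μ d : ℝ) * ind 1 β D d * (liouville d : ℝ) * ((Real.log (y / d) * mL - gL) / d) -
      π ^ 2 / 6 * ((μ d : ℝ) * ind 1 β D d * (liouville d : ℝ) / d) =
      (μ d : ℝ) * ind 1 β D d * (liouville d : ℝ) / d * (Real.log (y / d) * mL - (gL + π ^ 2 / 6)) := by
    field_simp
    ring
  rw [hexpr, abs_mul, abs_div, abs_of_pos hd0]
  refine mul_le_mul (div_le_div_of_nonneg_right hcoef hd0.le) ?_ (abs_nonneg _) (div_nonneg hind0 hd0.le)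
  calc |Real.log (y / d) * mL - (gL + π ^ 2 / 6)| ≤ |Real.log (y / d) * mL| + |gL + π ^ 2 / 6| := abs_sub _ _
    _ = |Real.log (y / d)| * |mL| + |gL + π ^ 2 / 6| := by rw [abs_mul]

end Literature.Barriers.Parity.MatomakiMerikoski
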